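import Mathlib
import HarnessLib
import Literature.MathematicalPhysics.QuantumLattice.KohnLuttinger
import Literature.MathematicalPhysics.QuantumLattice.KohnLuttingerLindhardMeasurable
import Literature.MathematicalPhysics.QuantumLattice.KohnLuttingerChannelStates
import Summits.HubbardSuperconductivity.HubbardSuperconductivity.Theorems.WeakCouplingBCSWcbcsKohnLuttingerB1gReduction
import Summits.HubbardSuperconductivity.HubbardSuperconductivity.Theorems.WeakCouplingBCSWcbcsKohnLuttingerB1gMuWindow
import Summits.HubbardSuperconductivity.HubbardSuperconductivity.Theorems.ChiralWindowCwKLChiralWindowD4Invariant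
import Summits.HubbardSuperconductivity.HubbardSuperconductivity.Theorems.ChiralWindowCwKLChiralWindowSectorProj
import Summits.HubbardSuperconductivity.HubbardSuperconductivity.Theorems.WeakCouplingBCSDefsKlCertTPrime
import Summits.HubbardSuperconductivity.HubbardSuperconductivity.Theorems.WeakCouplingBCSKlCertTPrimePHReflectionShift
import Summits.HubbardSuperconductivity.HubbardSuperconductivity.Theorems.WeakCouplingBCSKlCertTPrimePHReflectionMeasure

/-!
# Route `WeakCouplingBCS` — particle–hole ⊗ `(π, π)` reflection of the Kohn–Luttinger data, III: channel states and
# channel bottoms (located item «(KLSCAN)-TPRIME-PH-REFLECTION», certificate half of stmt-HubbardSuperconductivity-0158; file 3 of 3)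

Main results (no hypotheses on `t′`, `μ`, `U`, `χ`):

* **`channelInf_ph_reflection`**: `channelInf (squareDispersion 1 tp) μ U χ = channelInf (squareDispersion 1 (-tp)) (-μ) U χ`
  — the bottom of the second-order Kohn–Luttinger pairing vertex in every `D₄` channel is invariant under
  `(t′, μ) ↦ (-t′, -μ)`.  So an `M`-centred Fermi pocket of `(t′, μ)` (`μ > 4t′` at `t′ < 0`, where the tree's `Γ`-polar trial
  functions `KLTrig.toFun` do not describe the pocket) is certified through the `Γ`-centred cell `(-t′, -μ)` VERBATIM
  (refuter hubbard-klscan-crit-1, 2026-08-28; Šimkovic–Liu–Deng–Kozik 2016 §III.A).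
* the filling identity `KohnLuttinger.filling ε_{t′} μ = 2 - KohnLuttinger.filling ε_{-t′} (-μ)` is `klph_filling_ph` of
  file 2 (hole doping of `(t′, μ)` = electron doping of `(-t′, -μ)`); here, in the scan-table vocabulary of `…WeakCouplingBCSDefsKlCertTPrime`:
  `klDopingOfMuTP tp μ = -klDopingOfMuTP (-tp) (-μ)`, `KLB1gDominatesAtTP tp a b γ ↔ KLB1gDominatesAtTP (-tp) (-b) (-a) γ`,
  `KLB1gDominatesTP tp a b γ ↔ KLB1gDominatesTP (-tp) (-b) (-a) γ`.

Proof (§2): a channel state `ψ` of `(t′, μ)` is transported to `φ := 𝟙_G · (ψ ∘ T)` (`T = klphShift`, `G = klphGood` of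
file 1): `φ` is in the same channel EXACTLY (pointwise — `G` is `D₄`-invariant and `T` commutes with `D₄` on it), equals
`ψ ∘ T` almost everywhere because the four exceptional lines `kᵢ ∈ {0, -π}` are null for every Fermi-curve measure (§1:
the line meets the Fermi curve in a countable set, or — in the degenerate cases `t′ = ∓½` at the matching level — the Fermi
velocity vanishes identically on it and the density `‖∇ε‖⁻¹` is `0`), and has the same `L²` norm and pairing form because
`T` pushes `σ[ε_{-t′}, -μ]` to `σ[ε_{t′}, μ]` and transports the kernel (file 2).  Applying the one-directional transport to
`(t′, μ)` and to `(-t′, -μ)` shows the two value sets `pairingForm '' {channel states}` COINCIDE, so their `sInf` agree with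
no non-emptiness or boundedness hypothesis.

NOT claimed: `klMuOfDopingTP tp δ = -klMuOfDopingTP (-tp) (-δ)` (it needs strict monotonicity of the filling, i.e.
positivity of the density of states on the band; the scan rows are `μ`-windows and do not need it).  Nothing here asserts a
margin at any `t′`, a doping window, or superconductivity.  No definitions.
References: S. Raghu, S. A. Kivelson, D. J. Scalapino, Phys. Rev. B 81 (2010) 224505, §II (7), (13), §III (17);
F. Šimkovic, X.-W. Liu, Y. Deng, E. Kozik, Phys. Rev. B 94 (2016) 085106, §III.A.
-/

noncomputable section

-- the tree's namespace `Summit.<Summit>.<Problem>.Theorems` repeats the summit name by design (D-0017)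
set_option linter.dupNamespace false

namespace Summit.HubbardSuperconductivity.HubbardSuperconductivity.Theorems

open MeasureTheory Set Real Literature.MathematicalPhysics.QuantumLattice
open scoped ENNReal

/-! ### §1 The four exceptional lines carry no Fermi-curve measure -/

/-- A measurable set `L` on which either the Fermi curve is countable or the Fermi velocity vanishes is
null for the Fermi-curve measure (arc length has no atoms; the density `‖∇ε‖⁻¹` is Lean's `0⁻¹ = 0` at
critical points). [folklore] -/
theorem klph_fermiCurveMeasure_null_of_countable_or_gradient {ε : Momentum → ℝ} (hε : Measurable ε) (μ : ℝ)
    {L : Set Momentum} (hL : MeasurableSet L)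
    (h : (L ∩ fermiCurve ε μ).Countable ∨ ∀ k ∈ L, gradient ε k = 0) :
    fermiCurveMeasure ε μ L = 0 := by
  haveI := Measure.nullSingletonClass_hausdorff Momentum (d := 1) one_pos
  unfold fermiCurveMeasure
  rw [withDensity_apply _ hL, Measure.restrict_restrict hL]
  rcases h with hc | hg
  · rw [Measure.restrict_eq_zero.2 (hc.measure_zero _), lintegral_zero_measure]
  · rw [setLIntegral_congr_fun (hL.inter (measurableSet_fermiCurve hε μ))
      (fun k hk => by rw [hg k hk.1, norm_zero, inv_zero, ENNReal.ofReal_zero]), lintegral_zero]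

/-- **The lines `k₀ = 0` and `k₀ = -π` are null for the Fermi-curve measure of every `t`–`t′` band at
every level**: on such a line `ε_s(c, k₁) = -2 cos c - 2(1 + 2s cos c) cos k₁`; if the coefficient
`1 + 2s cos c ≠ 0` the line meets the Fermi curve in a countable set, otherwise `∇ε_s` vanishes
identically on the line. [folklore] -/
theorem klph_fermiCurveMeasure_line_fst (s μ c : ℝ) (hc : c = 0 ∨ c = -π) :
    fermiCurveMeasure (squareDispersion 1 s) μ {k : Momentum | k 0 = c} = 0 := by
  have hsin : sin c = 0 := by rcases hc with rfl | rfl <;> simp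
  have hc0 : Measurable fun k : Momentum => k 0 := (PiLp.continuous_apply 2 (fun _ : Fin 2 => ℝ) 0).measurable
  have hL : MeasurableSet {k : Momentum | k 0 = c} := hc0 (measurableSet_singleton c)
  refine klph_fermiCurveMeasure_null_of_countable_or_gradient (measurable_squareDispersion 1 s) μ hL ?_
  by_cases hA : 1 + 2 * s * cos c = 0
  · refine Or.inr fun k hk => ?_
    have hk0 : k 0 = c := hk
    rw [klph_gradient_squareDispersion]
    ext i
    fin_cases i <;> simp [hk0, hsin, hA]
  · refine Or.inl ?_
    set d : ℝ := (-μ - 2 * cos c) / (2 * (1 + 2 * s * cos c)) with hd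
    have hsub : {k : Momentum | k 0 = c} ∩ fermiCurve (squareDispersion 1 s) μ ⊆
        (fun y : ℝ => (WithLp.toLp 2 ![c, y] : Momentum)) '' {y : ℝ | cos y = d} := by
      rintro k ⟨hk0, hkF⟩
      have hk0' : k 0 = c := hk0
      have hε : squareDispersion 1 s k = μ := hkF.2
      refine ⟨k 1, ?_, ?_⟩
      · simp only [mem_setOf_eq, hd]
        rw [eq_div_iff (mul_ne_zero two_ne_zero hA)]
        simp only [squareDispersion, hk0'] at hε
        linarith
      · ext i; fin_cases i <;> simp [hk0']
    exact ((countable_setOf_cos_eq d).image _).mono hsub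

/-- The same for the lines `k₁ = 0` and `k₁ = -π`. [folklore] -/
theorem klph_fermiCurveMeasure_line_snd (s μ c : ℝ) (hc : c = 0 ∨ c = -π) :
    fermiCurveMeasure (squareDispersion 1 s) μ {k : Momentum | k 1 = c} = 0 := by
  have hsin : sin c = 0 := by rcases hc with rfl | rfl <;> simp
  have hc1 : Measurable fun k : Momentum => k 1 := (PiLp.continuous_apply 2 (fun _ : Fin 2 => ℝ) 1).measurable
  have hL : MeasurableSet {k : Momentum | k 1 = c} := hc1 (measurableSet_singleton c)
  refine klph_fermiCurveMeasure_null_of_countable_or_gradient (measurable_squareDispersion 1 s) μ hL ?_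
  by_cases hA : 1 + 2 * s * cos c = 0
  · refine Or.inr fun k hk => ?_
    have hk1 : k 1 = c := hk
    rw [klph_gradient_squareDispersion]
    ext i
    fin_cases i <;> simp [hk1, hsin, hA]
  · refine Or.inl ?_
    set d : ℝ := (-μ - 2 * cos c) / (2 * (1 + 2 * s * cos c)) with hd
    have hsub : {k : Momentum | k 1 = c} ∩ fermiCurve (squareDispersion 1 s) μ ⊆
        (fun y : ℝ => (WithLp.toLp 2 ![y, c] : Momentum)) '' {y : ℝ | cos y = d} := by
      rintro k ⟨hk1, hkF⟩
      have hk1' : k 1 = c := hk1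
      have hε : squareDispersion 1 s k = μ := hkF.2
      refine ⟨k 0, ?_, ?_⟩
      · simp only [mem_setOf_eq, hd]
        rw [eq_div_iff (mul_ne_zero two_ne_zero hA)]
        simp only [squareDispersion, hk1'] at hε
        linarith
      · ext i; fin_cases i <;> simp [hk1']
    exact ((countable_setOf_cos_eq d).image _).mono hsub


/-- **The good set has full Fermi-curve measure** for every `t`–`t′` band at every level (the measure
lives on the Fermi curve `⊆ BZ`, and the four exceptional lines are null, §7). [folklore] -/
theorem ae_mem_klphGood (s μ : ℝ) :
    ∀ᵐ k ∂fermiCurveMeasure (squareDispersion 1 s) μ, k ∈ klphGood := by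
  have hF := ae_mem_fermiCurve (measurable_squareDispersion 1 s) μ
  have l1 := measure_eq_zero_iff_ae_notMem.1 (klph_fermiCurveMeasure_line_fst s μ 0 (Or.inl rfl))
  have l2 := measure_eq_zero_iff_ae_notMem.1 (klph_fermiCurveMeasure_line_fst s μ (-π) (Or.inr rfl))
  have l3 := measure_eq_zero_iff_ae_notMem.1 (klph_fermiCurveMeasure_line_snd s μ 0 (Or.inl rfl))
  have l4 := measure_eq_zero_iff_ae_notMem.1 (klph_fermiCurveMeasure_line_snd s μ (-π) (Or.inr rfl))
  filter_upwards [hF, l1, l2, l3, l4] with k hk h1 h2 h3 h4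
  have hk0 : k 0 ∈ Ico (-π) π := hk.1 0
  have hk1 : k 1 ∈ Ico (-π) π := hk.1 1
  have h1' : k 0 ≠ 0 := h1
  have h2' : k 0 ≠ -π := h2
  have h3' : k 1 ≠ 0 := h3
  have h4' : k 1 ≠ -π := h4
  rw [klphGood, mem_setOf_eq, Fin.forall_fin_two]
  exact ⟨⟨abs_pos.2 h1', abs_lt.2 ⟨lt_of_le_of_ne hk0.1 (Ne.symm h2'), hk0.2⟩⟩,
    ⟨abs_pos.2 h3', abs_lt.2 ⟨lt_of_le_of_ne hk1.1 (Ne.symm h4'), hk1.2⟩⟩⟩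


/-! ### §2 Transport of channel states and the channel bottoms -/

/-- **Transport of channel states.** If `ψ` is a normalised `L²(σ[ε_{t′}, μ])` gap function in the
channel `χ`, then `φ := 𝟙_G · (ψ ∘ T)` (`G` the good set) is a normalised `L²(σ[ε_{-t′}, -μ])` gap
function in the SAME channel (exactly, pointwise: `G` is `D₄`-invariant and `T` commutes with `D₄` on it),
it agrees with `ψ ∘ T` almost everywhere, and it has the same pairing form at every coupling `U`
(kernel and measure are transported by `T`). [cite: RaghuKivelsonScalapino2010, §II (7) and §III (17)] -/
theorem klph_isChannelState_transport (tp μ : ℝ) (χ : D4Irrep) {ψ : Momentum → ℝ}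
    (hψ : IsChannelState (squareDispersion 1 tp) μ χ ψ) :
    IsChannelState (squareDispersion 1 (-tp)) (-μ) χ (klphGood.indicator (ψ ∘ klphShift)) ∧
      ∀ U : ℝ, pairingForm (squareDispersion 1 (-tp)) (-μ) U (klphGood.indicator (ψ ∘ klphShift)) =
        pairingForm (squareDispersion 1 tp) μ U ψ := by
  obtain ⟨hmem, hnorm, hch⟩ := hψ
  have hmp := klph_measurePreserving_shift_fermiCurveMeasure tp μ
  have hG : ∀ᵐ k ∂fermiCurveMeasure (squareDispersion 1 (-tp)) (-μ), k ∈ klphGood :=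
    ae_mem_klphGood (-tp) (-μ)
  have hBZ : ∀ᵐ k ∂fermiCurveMeasure (squareDispersion 1 (-tp)) (-μ), k ∈ brillouinZone :=
    hG.mono fun k hk => klphGood_subset_brillouinZone hk
  have hae : klphGood.indicator (ψ ∘ klphShift) =ᵐ[fermiCurveMeasure (squareDispersion 1 (-tp)) (-μ)]
      (ψ ∘ klphShift) := by
    filter_upwards [hG] with k hk
    simp only [Set.indicator_of_mem hk]
  -- (1) the transported function lies in the channel, pointwise
  have hchφ : InChannel χ (klphGood.indicator (ψ ∘ klphShift)) := by
    funext k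
    by_cases hk : k ∈ klphGood
    · have hψk := congrFun hch (klphShift k)
      simp only [d4Project] at hψk ⊢
      rw [Set.indicator_of_mem hk, Function.comp_apply, ← hψk]
      congr 1
      refine Finset.sum_congr rfl fun γ _ => ?_
      rw [Set.indicator_of_mem ((d4Momentum_mem_klphGood_iff γ k).2 hk), Function.comp_apply,
        klphShift_d4Momentum γ hk]
    · simp only [d4Project, Set.indicator_of_notMem hk]
      rw [Finset.sum_eq_zero (fun γ _ => ?_), mul_zero]
      rw [Set.indicator_of_notMem (fun h => hk ((d4Momentum_mem_klphGood_iff γ k).1 h)), mul_zero]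
  -- (2) square integrability and (3) normalisation
  have hmemφ : MemLp (klphGood.indicator (ψ ∘ klphShift)) 2 (fermiCurveMeasure (squareDispersion 1 (-tp)) (-μ)) :=
    (hmem.comp_measurePreserving hmp).ae_eq hae.symm
  have hnormφ : ∫ k, klphGood.indicator (ψ ∘ klphShift) k ^ 2 ∂fermiCurveMeasure (squareDispersion 1 (-tp)) (-μ) = 1 := by
    have h1 : ∫ k, klphGood.indicator (ψ ∘ klphShift) k ^ 2 ∂fermiCurveMeasure (squareDispersion 1 (-tp)) (-μ) =
        ∫ k, ψ (klphShift k) ^ 2 ∂fermiCurveMeasure (squareDispersion 1 (-tp)) (-μ) :=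
      integral_congr_ae (hae.mono fun k hk => by simp only [hk, Function.comp_apply])
    rw [h1]
    exact (hmp.integral_comp klph_measurableEmbedding_shift (fun k => ψ k ^ 2)).trans hnorm
  refine ⟨⟨hmemφ, hnormφ, hchφ⟩, fun U => ?_⟩
  -- (4) the pairing form: transport the inner integral, then the outer one
  have hinner : ∀ k ∈ brillouinZone,
      ∫ k', kohnLuttingerKernel (squareDispersion 1 (-tp)) (-μ) U k k' * klphGood.indicator (ψ ∘ klphShift) k'
          ∂fermiCurveMeasure (squareDispersion 1 (-tp)) (-μ) =
        ∫ k', kohnLuttingerKernel (squareDispersion 1 tp) μ U (klphShift k) k' * ψ k'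
          ∂fermiCurveMeasure (squareDispersion 1 tp) μ := by
    intro k hk
    have h1 : ∫ k', kohnLuttingerKernel (squareDispersion 1 (-tp)) (-μ) U k k' *
          klphGood.indicator (ψ ∘ klphShift) k' ∂fermiCurveMeasure (squareDispersion 1 (-tp)) (-μ) =
        ∫ k', kohnLuttingerKernel (squareDispersion 1 tp) μ U (klphShift k) (klphShift k') * ψ (klphShift k')
          ∂fermiCurveMeasure (squareDispersion 1 (-tp)) (-μ) := by
      refine integral_congr_ae ?_
      filter_upwards [hae, hBZ] with k' hk' hk'BZ
      rw [hk', Function.comp_apply, klph_kohnLuttingerKernel_shift tp μ U hk hk'BZ]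
    rw [h1]
    exact hmp.integral_comp klph_measurableEmbedding_shift
      (fun k' => kohnLuttingerKernel (squareDispersion 1 tp) μ U (klphShift k) k' * ψ k')
  unfold pairingForm
  have h2 : ∫ k, klphGood.indicator (ψ ∘ klphShift) k *
        ∫ k', kohnLuttingerKernel (squareDispersion 1 (-tp)) (-μ) U k k' * klphGood.indicator (ψ ∘ klphShift) k'
          ∂fermiCurveMeasure (squareDispersion 1 (-tp)) (-μ) ∂fermiCurveMeasure (squareDispersion 1 (-tp)) (-μ) =
      ∫ k, ψ (klphShift k) * ∫ k', kohnLuttingerKernel (squareDispersion 1 tp) μ U (klphShift k) k' * ψ k'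
          ∂fermiCurveMeasure (squareDispersion 1 tp) μ ∂fermiCurveMeasure (squareDispersion 1 (-tp)) (-μ) := by
    refine integral_congr_ae ?_
    filter_upwards [hae, hBZ] with k hk hkBZ
    rw [hk, Function.comp_apply, hinner k hkBZ]
  rw [h2]
  exact hmp.integral_comp klph_measurableEmbedding_shift
    (fun k => ψ k * ∫ k', kohnLuttingerKernel (squareDispersion 1 tp) μ U k k' * ψ k'
      ∂fermiCurveMeasure (squareDispersion 1 tp) μ)

/-- The value set of the pairing form on channel states of `(t′, μ)` is contained in that of
`(-t′, -μ)`. [folklore] -/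
theorem klph_pairingForm_image_subset (tp μ U : ℝ) (χ : D4Irrep) :
    pairingForm (squareDispersion 1 tp) μ U '' {ψ | IsChannelState (squareDispersion 1 tp) μ χ ψ} ⊆
      pairingForm (squareDispersion 1 (-tp)) (-μ) U ''
        {ψ | IsChannelState (squareDispersion 1 (-tp)) (-μ) χ ψ} := by
  rintro _ ⟨ψ, hψ, rfl⟩
  obtain ⟨hφ, hval⟩ := klph_isChannelState_transport tp μ χ hψ
  exact ⟨_, hφ, hval U⟩

/-- **The value sets of the pairing form on the channel states of `(t′, μ)` and of `(-t′, -μ)`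
coincide** (the reflection is an involution). [folklore] -/
theorem klph_pairingForm_image_eq (tp μ U : ℝ) (χ : D4Irrep) :
    pairingForm (squareDispersion 1 tp) μ U '' {ψ | IsChannelState (squareDispersion 1 tp) μ χ ψ} =
      pairingForm (squareDispersion 1 (-tp)) (-μ) U ''
        {ψ | IsChannelState (squareDispersion 1 (-tp)) (-μ) χ ψ} :=
  (klph_pairingForm_image_subset tp μ U χ).antisymm
    (by simpa using klph_pairingForm_image_subset (-tp) (-μ) U χ)

/-- **«(KLSCAN)-TPRIME-PH-REFLECTION» — the channel bottoms are particle–hole ⊗ `(π, π)` invariant**: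
`channelInf ε_{t′} μ U χ = channelInf ε_{-t′} (-μ) U χ` for every hopping `t′`, chemical potential `μ`,
coupling `U` and `D₄` channel `χ`.  An `M`-centred Fermi pocket of `(t′, μ)` (`μ > 4t′` at `t′ < 0`) is
thereby the `Γ`-centred Fermi curve of `(-t′, -μ)`, on which the tree's `Γ`-polar trial functions and
certificates apply verbatim (Šimkovic–Deng–Kozik et al. 2016, §3.1: «for `t′ < 0` the diagram is obtained
by reflection about `(t′ = 0, n = 1)`»).  No hypothesis: both sides are `sInf` of the SAME set of reals.
[cite: RaghuKivelsonScalapino2010, §II (7), (13) and §III (17)] -/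
theorem channelInf_ph_reflection (tp μ U : ℝ) (χ : D4Irrep) :
    channelInf (squareDispersion 1 tp) μ U χ = channelInf (squareDispersion 1 (-tp)) (-μ) U χ := by
  unfold channelInf
  rw [klph_pairingForm_image_eq]

/-! ### §3 Corollaries in the vocabulary of the `(δ, t′)` scan table -/

/-- **Hole doping ↔ electron doping**: `δ(μ; t′) = -δ(-μ; -t′)` (`klDopingOfMuTP = 1 - n`). [folklore] -/
theorem klDopingOfMuTP_ph_reflection (tp μ : ℝ) : klDopingOfMuTP tp μ = -klDopingOfMuTP (-tp) (-μ) := by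
  unfold klDopingOfMuTP
  rw [klph_filling_ph tp μ]
  ring

/-- A `B1g`-dominance row (`U = 1`) for the reflected cell `(-t′, [-b, -a])` IS the row for `(t′, [a, b])`.
[folklore] -/
theorem klB1gDominatesAtTP_of_ph_reflection {tp a b γ : ℝ} (h : KLB1gDominatesAtTP (-tp) (-b) (-a) γ) :
    KLB1gDominatesAtTP tp a b γ := by
  intro μ hμ χ hχ
  have hμ' : -μ ∈ Set.Icc (-b) (-a) := ⟨neg_le_neg hμ.2, neg_le_neg hμ.1⟩
  have h' := h (-μ) hμ' χ hχ
  rwa [← channelInf_ph_reflection tp μ 1 D4Irrep.B1g, ← channelInf_ph_reflection tp μ 1 χ] at h'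

/-- **`KLB1gDominatesAtTP tp a b γ ↔ KLB1gDominatesAtTP (-tp) (-b) (-a) γ`**: an `M`-pocket row at
`(t′, [a, b])` is certified by a `Γ`-row of `squareDispersion 1 (-t′)` on `[-b, -a]` and conversely.
[folklore] -/
theorem klB1gDominatesAtTP_ph_reflection_iff (tp a b γ : ℝ) :
    KLB1gDominatesAtTP tp a b γ ↔ KLB1gDominatesAtTP (-tp) (-b) (-a) γ :=
  ⟨fun h => klB1gDominatesAtTP_of_ph_reflection (by simpa using h), klB1gDominatesAtTP_of_ph_reflection⟩

/-- The same for the all-coupling rows: a `KLB1gDominatesTP` row for `(-t′, [-b, -a])` IS the row for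
`(t′, [a, b])`. [folklore] -/
theorem klB1gDominatesTP_of_ph_reflection {tp a b γ : ℝ} (h : KLB1gDominatesTP (-tp) (-b) (-a) γ) :
    KLB1gDominatesTP tp a b γ := by
  intro μ hμ U hU χ hχ
  have hμ' : -μ ∈ Set.Icc (-b) (-a) := ⟨neg_le_neg hμ.2, neg_le_neg hμ.1⟩
  have h' := h (-μ) hμ' U hU χ hχ
  rwa [← channelInf_ph_reflection tp μ U D4Irrep.B1g, ← channelInf_ph_reflection tp μ U χ] at h'

/-- **`KLB1gDominatesTP tp a b γ ↔ KLB1gDominatesTP (-tp) (-b) (-a) γ`.** [folklore] -/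
theorem klB1gDominatesTP_ph_reflection_iff (tp a b γ : ℝ) :
    KLB1gDominatesTP tp a b γ ↔ KLB1gDominatesTP (-tp) (-b) (-a) γ :=
  ⟨fun h => klB1gDominatesTP_of_ph_reflection (by simpa using h), klB1gDominatesTP_of_ph_reflection⟩

end Summit.HubbardSuperconductivity.HubbardSuperconductivity.Theorems

end
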